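import Mathlib
import HarnessLib
import Summits.HubbardSuperconductivity.HubbardSuperconductivity.Theorems.WeakCouplingBCSKlThirdOrderSlot
import Summits.HubbardSuperconductivity.HubbardSuperconductivity.Theorems.WeakCouplingBCSKlCertTPm03ChiHSOfEnclosures

/-!
# WeakCouplingBCS — KL certificate: the third-order `U₀` slot at `t′ ≠ 0` — generic frame identification and the `(δ, t′) = (⅛, −0.3)` rows

`…KlThirdOrderSlot` (✓ p732729) proves `KLChannelRemainderBound tp a b (klLambda3 tp) M U₁` for EVERY `t′` but identifies `klLambda3` with the
tree's `channelInf3` only at `t′ = 0` (`klLambda3_zero_eq`, via `stub_klFrameHS`).  This file supplies the `t′`-GENERIC identification from the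
Hilbert–Schmidt frame hypotheses of the `t′` lane (finite Fermi-curve measure + `χ₀(·+·) ∈ L²(σ_μ ⊗ σ_μ)`, ✓ `klhs_frame_pairingForm_split`) and the
resulting third-order selection theorem for ANY certified `t′` row `KLB1gDominatesTP tp a b γ`; and it instantiates both BY NAME at the scan cell
`(δ, t′) = (⅛, −0.3)` — records `klCertB1gTPm03D0125` ((δ): `γ = 33811/2²⁰`, ✓ `klCertB1gTPm03D0125_dominates_of_E`) and its JOINT twin ((ε′):
`γ_J = 88361/2²⁰`, ✓ `…_dominatesJ_of_E`), whose frame is a THEOREM of the tree (✓ `kltp_m03_HS`, ✓ `kltp_isFiniteMeasure_pocket` on `μ ∈ [−1, −9/10]`):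

* §1 `klLambda3_eq_of_frame`: `[IsFiniteMeasure σ_μ] → MemLp χ₀(·+·) 2 (σ_μ ⊗ σ_μ) → 0 < U → klLambda3 tp χ μ U = U² · channelInf3 ε_{t′} μ U χ`.
* §2 `klChannelInf3_B1g_lt_of_dominatesTP`: `KLB1gDominatesTP tp a b γ`, `0 < γ`, `0 ≤ M`, `FormBound tp a b M`, frame on `[a, b]` ⇒ for
  `μ ∈ [a, b]`, `0 < U < klU0 γ M 1`, `χ ≠ B1g`: `channelInf3 ε_{t′} μ U B1g < channelInf3 ε_{t′} μ U χ`.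
* §3 the `(⅛, −0.3)` rows `klChannelInf3_B1g_lt_TPm03D0125` / `…TPm03D0125J` (modulo `hE` = the record's certified enclosures, RECORD class, and
  `hM : FormBound (−3/10) mub mua M`, `M` ABSTRACT — no two-loop tables exist at `t′ ≠ 0`; the frame is discharged by the tree).

Honest framing: statements-first; `M` is a hypothesis; register expectation 0.00 (it completes «any `t′` row slots in» of ✓ p731561 §4 by decl);
RECORD ≠ DECIDED (W3′ alone DECIDED); third-order truncation of the pp-irreducible vertex; a Kohn–Luttinger channel statement is not ODLRO and
nothing here proves superconductivity in the Hubbard model.  Filed `--supports stmt-HubbardSuperconductivity-0158`.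

References: S. Raghu, S. A. Kivelson, D. J. Scalapino, Phys. Rev. B 81 (2010) 224505, §III Fig. 3, §IV–V, App. A.
-/

noncomputable section

-- the tree's namespace `Summit.<Summit>.<Problem>.Theorems` repeats the summit name by design (D-0017)
set_option linter.dupNamespace false

namespace Summit.HubbardSuperconductivity.HubbardSuperconductivity.Theorems

open MeasureTheory Literature.MathematicalPhysics.QuantumLattice CwKLChiralWindow KlThirdOrder KlCertTPrimeJoint
open scoped Pointwise

/-! ### §1 The `t′`-generic frame identification -/

/-- Under the Hilbert–Schmidt frame at `(t′, μ)` (finite `σ_μ`, `χ₀(·+·) ∈ L²(σ_μ ⊗ σ_μ)`), for `U ≠ 0` and `ψ ∈ L²(σ_μ)`: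
`pairingForm ε_{t′} μ U ψ + U³⟨ψ, K₃ ψ⟩ = U² · thirdOrderForm ε_{t′} μ U ψ`. [folklore] -/
theorem kl_pairingForm_add_cube_eq_sq_mul_thirdOrderForm_of_frame {tp μ : ℝ}
    [IsFiniteMeasure (fermiCurveMeasure (squareDispersion 1 tp) μ)]
    (hK : MemLp (fun z : Momentum × Momentum => lindhardFunction (squareDispersion 1 tp) μ (z.1 + z.2)) 2
      ((fermiCurveMeasure (squareDispersion 1 tp) μ).prod (fermiCurveMeasure (squareDispersion 1 tp) μ)))
    {U : ℝ} (hU : U ≠ 0) {ψ : Momentum → ℝ} (hψ : MemLp ψ 2 (fermiCurveMeasure (squareDispersion 1 tp) μ)) :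
    pairingForm (squareDispersion 1 tp) μ U ψ +
        U ^ 3 * kform (fermiCurveMeasure (squareDispersion 1 tp) μ) (klThirdOrderKernel (squareDispersion 1 tp) μ) ψ =
      U ^ 2 * thirdOrderForm (squareDispersion 1 tp) μ U ψ := by
  rw [klhs_frame_pairingForm_split U hK hψ]
  unfold thirdOrderForm kform lindhardKernel
  field_simp

/-- **`Λ₃ = U² · channelInf3` under the frame at `(t′, μ)`**: finite `σ_μ`, `χ₀(·+·) ∈ L²(σ_μ ⊗ σ_μ)`, `0 < U`.
[cite: RaghuKivelsonScalapino2010, §V (25)] -/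
theorem klLambda3_eq_of_frame {tp μ : ℝ} [IsFiniteMeasure (fermiCurveMeasure (squareDispersion 1 tp) μ)]
    (hK : MemLp (fun z : Momentum × Momentum => lindhardFunction (squareDispersion 1 tp) μ (z.1 + z.2)) 2
      ((fermiCurveMeasure (squareDispersion 1 tp) μ).prod (fermiCurveMeasure (squareDispersion 1 tp) μ)))
    {U : ℝ} (hU : 0 < U) (χ : D4Irrep) :
    klLambda3 tp χ μ U = U ^ 2 * channelInf3 (squareDispersion 1 tp) μ U χ := by
  unfold klLambda3 channelInf3
  have himg : (fun ψ => pairingForm (squareDispersion 1 tp) μ U ψ +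
        U ^ 3 * kform (fermiCurveMeasure (squareDispersion 1 tp) μ) (klThirdOrderKernel (squareDispersion 1 tp) μ) ψ) ''
        {ψ | IsChannelState (squareDispersion 1 tp) μ χ ψ} =
      (U ^ 2) • ((thirdOrderForm (squareDispersion 1 tp) μ U) '' {ψ | IsChannelState (squareDispersion 1 tp) μ χ ψ}) := by
    rw [← Set.image_smul, Set.image_image]
    refine Set.image_congr fun ψ hψ => ?_
    rw [smul_eq_mul]
    exact kl_pairingForm_add_cube_eq_sq_mul_thirdOrderForm_of_frame hK hU.ne' hψ.1
  rw [himg, Real.sInf_smul_of_nonneg (sq_nonneg U), smul_eq_mul]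

/-! ### §2 Third-order selection from ANY certified `t′` row -/

/-- **Third-order `B1g` selection from a `t′` row.** `KLB1gDominatesTP tp a b γ` with `0 < γ`, the two-sided third-order enclosure
`FormBound tp a b M` (`0 ≤ M`), and the Hilbert–Schmidt frame on the window (finite `σ_μ` and `χ₀(·+·) ∈ L²(σ_μ ⊗ σ_μ)` for `μ ∈ [a, b]`) give,
for `μ ∈ [a, b]`, `0 < U < klU0 γ M 1 = min(1, γ/2M)` and `χ ≠ B1g`: `channelInf3 ε_{t′} μ U B1g < channelInf3 ε_{t′} μ U χ`.
[cite: RaghuKivelsonScalapino2010, §II (13), §IV] -/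
theorem klChannelInf3_B1g_lt_of_dominatesTP {tp a b γ M : ℝ} (hD : KLB1gDominatesTP tp a b γ) (hγ : 0 < γ) (hM : 0 ≤ M)
    (hF : KlThirdOrder.FormBound tp a b M)
    (hfin : ∀ μ ∈ Set.Icc a b, IsFiniteMeasure (fermiCurveMeasure (squareDispersion 1 tp) μ))
    (hK : ∀ μ ∈ Set.Icc a b, MemLp (fun z : Momentum × Momentum => lindhardFunction (squareDispersion 1 tp) μ (z.1 + z.2)) 2
      ((fermiCurveMeasure (squareDispersion 1 tp) μ).prod (fermiCurveMeasure (squareDispersion 1 tp) μ)))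
    {μ : ℝ} (hμ : μ ∈ Set.Icc a b) {U : ℝ} (hU0 : 0 < U) (hU : U < klU0 γ M 1) {χ : D4Irrep} (hχ : χ ≠ D4Irrep.B1g) :
    channelInf3 (squareDispersion 1 tp) μ U D4Irrep.B1g < channelInf3 (squareDispersion 1 tp) μ U χ := by
  haveI := hfin μ hμ
  have h := klB1g_full_lt_of_lt_klU0 hD (klChannelRemainderBound_lambda3 hM hF 1) hM hγ hμ hU0 hU hχ
  rw [klLambda3_eq_of_frame (hK μ hμ) hU0, klLambda3_eq_of_frame (hK μ hμ) hU0] at h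
  exact lt_of_mul_lt_mul_left h (sq_nonneg U)

/-! ### §3 The `(δ, t′) = (⅛, −0.3)` rows -/

/-- The record window of `klCertB1gTPm03D0125` lies in `[−1, −9/10]` (where the frame is a theorem of the tree). [folklore] -/
theorem klCertB1gTPm03D0125_window_mem {μ : ℝ}
    (hμ : μ ∈ Set.Icc ((klCertB1gTPm03D0125.mub : ℚ) : ℝ) ((klCertB1gTPm03D0125.mua : ℚ) : ℝ)) : -1 ≤ μ ∧ μ ≤ -9 / 10 := by
  have hlo : ((klCertB1gTPm03D0125.mub : ℚ) : ℝ) = ((-4321685426123455 : ℚ) / 4503599627370496 : ℚ) := rfl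
  have hhi : ((klCertB1gTPm03D0125.mua : ℚ) : ℝ) = ((-8643302132770191 : ℚ) / 9007199254740992 : ℚ) := rfl
  obtain ⟨h1, h2⟩ := hμ
  rw [hlo] at h1
  rw [hhi] at h2
  push_cast at h1 h2
  exact ⟨by linarith, by linarith⟩

/-- The frame at `t′ = −3/10` on `[−1, −9/10]`: the Fermi-curve measure is finite (tree: speed floor on the hole pocket). [folklore] -/
theorem kltp_m03_isFiniteMeasure {μ : ℝ} (hμ1 : -1 ≤ μ) (hμ2 : μ ≤ -9 / 10) :
    IsFiniteMeasure (fermiCurveMeasure (squareDispersion 1 (-3 / 10)) μ) :=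
  kltp_isFiniteMeasure_pocket (tp := -3 / 10) (by norm_num) (by norm_num) (by linarith) (by linarith) (by nlinarith)

/-- **Third-order selection at `(δ, t′) = (⅛, −0.3)`, (δ) record** (`γ = 33811/2²⁰ ≈ 0.0322`): for `μ ∈ [mub, mua]` (`≈ −0.9596`),
`0 < U < klU0 γ M 1` and `χ ≠ B1g`, `channelInf3 ε_{−0.3} μ U B1g < channelInf3 ε_{−0.3} μ U χ` — CONDITIONAL on `hE` (the record's certified
enclosures, RECORD class) and `hM` (two-sided third-order bound `M`, abstract here); the frame is discharged by ✓ `kltp_m03_HS` /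
✓ `kltp_isFiniteMeasure_pocket`. [cite: RaghuKivelsonScalapino2010, §III Fig. 3, §IV] -/
theorem klChannelInf3_B1g_lt_TPm03D0125 (hE : klCertB1gTPm03D0125.EnclosuresB1gTP (-3 / 10)) {M : ℝ} (hM : 0 ≤ M)
    (hF : KlThirdOrder.FormBound (-3 / 10) ((klCertB1gTPm03D0125.mub : ℚ) : ℝ) ((klCertB1gTPm03D0125.mua : ℚ) : ℝ) M)
    {μ : ℝ} (hμ : μ ∈ Set.Icc ((klCertB1gTPm03D0125.mub : ℚ) : ℝ) ((klCertB1gTPm03D0125.mua : ℚ) : ℝ)) {U : ℝ} (hU0 : 0 < U)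
    (hU : U < klU0 ((klCertB1gTPm03D0125.gamma : ℚ) : ℝ) M 1) {χ : D4Irrep} (hχ : χ ≠ D4Irrep.B1g) :
    channelInf3 (squareDispersion 1 (-3 / 10)) μ U D4Irrep.B1g < channelInf3 (squareDispersion 1 (-3 / 10)) μ U χ := by
  have hγ : (0 : ℝ) < ((klCertB1gTPm03D0125.gamma : ℚ) : ℝ) := by
    have : klCertB1gTPm03D0125.gamma = 33811 / 1048576 := rfl
    rw [this]; norm_num
  exact klChannelInf3_B1g_lt_of_dominatesTP (klCertB1gTPm03D0125_dominates_of_E hE) hγ hM hF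
    (fun ν hν => kltp_m03_isFiniteMeasure (klCertB1gTPm03D0125_window_mem hν).1 (klCertB1gTPm03D0125_window_mem hν).2)
    (fun ν hν => kltp_m03_HS (klCertB1gTPm03D0125_window_mem hν).1 (klCertB1gTPm03D0125_window_mem hν).2) hμ hU0 hU hχ

/-- **Third-order selection at `(δ, t′) = (⅛, −0.3)`, JOINT record** (`γ_J = 88361/2²⁰ ≈ 0.0843`): for `μ ∈ [mub, mua]`, `0 < U < klU0 γ_J M 1`
and `χ ≠ B1g`, `channelInf3 ε_{−0.3} μ U B1g < channelInf3 ε_{−0.3} μ U χ` — CONDITIONAL on the joint enclosures `hE` (RECORD class) and `hM`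
(abstract). [cite: RaghuKivelsonScalapino2010, §III Fig. 3, §IV] -/
theorem klChannelInf3_B1g_lt_TPm03D0125J (hE : JointEnclosuresB1gTP klCertB1gTPm03D0125 klCertB1gTPm03D0125JRows (-3 / 10))
    {M : ℝ} (hM : 0 ≤ M)
    (hF : KlThirdOrder.FormBound (-3 / 10) ((klCertB1gTPm03D0125.mub : ℚ) : ℝ) ((klCertB1gTPm03D0125.mua : ℚ) : ℝ) M)
    {μ : ℝ} (hμ : μ ∈ Set.Icc ((klCertB1gTPm03D0125.mub : ℚ) : ℝ) ((klCertB1gTPm03D0125.mua : ℚ) : ℝ)) {U : ℝ} (hU0 : 0 < U)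
    (hU : U < klU0 ((klCertB1gTPm03D0125GammaJ : ℚ) : ℝ) M 1) {χ : D4Irrep} (hχ : χ ≠ D4Irrep.B1g) :
    channelInf3 (squareDispersion 1 (-3 / 10)) μ U D4Irrep.B1g < channelInf3 (squareDispersion 1 (-3 / 10)) μ U χ := by
  have hγ : (0 : ℝ) < ((klCertB1gTPm03D0125GammaJ : ℚ) : ℝ) := by
    have : klCertB1gTPm03D0125GammaJ = 88361 / 1048576 := rfl
    rw [this]; norm_num
  exact klChannelInf3_B1g_lt_of_dominatesTP (klCertB1gTPm03D0125_dominatesJ_of_E hE) hγ hM hF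
    (fun ν hν => kltp_m03_isFiniteMeasure (klCertB1gTPm03D0125_window_mem hν).1 (klCertB1gTPm03D0125_window_mem hν).2)
    (fun ν hν => kltp_m03_HS (klCertB1gTPm03D0125_window_mem hν).1 (klCertB1gTPm03D0125_window_mem hν).2) hμ hU0 hU hχ

/-- Both `(⅛, −0.3)` thresholds are positive for every `M`: `0 < klU0 γ M 1` and `0 < klU0 γ_J M 1`. [folklore] -/
theorem klU0_TPm03D0125_pos (M : ℝ) :
    0 < klU0 ((klCertB1gTPm03D0125.gamma : ℚ) : ℝ) M 1 ∧ 0 < klU0 ((klCertB1gTPm03D0125GammaJ : ℚ) : ℝ) M 1 := by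
  have h1 : klCertB1gTPm03D0125.gamma = 33811 / 1048576 := rfl
  have h2 : klCertB1gTPm03D0125GammaJ = 88361 / 1048576 := rfl
  refine ⟨klU0_pos (by rw [h1]; norm_num) one_pos, klU0_pos (by rw [h2]; norm_num) one_pos⟩

end Summit.HubbardSuperconductivity.HubbardSuperconductivity.Theorems

end
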